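import Mathlib
import HarnessLib
import Summits.Ventures.LatticeQCDFlow.Scoring.ChainHoeffding
import Summits.Ventures.LatticeQCDFlow.Scoring.ChainMeanSquareError
import Summits.Ventures.LatticeQCDFlow.Scoring.WarmStartTransfer

/-!
# Certified confidence intervals for the time average of a Doeblin chain, from ANY start:
# with probability `≥ 1 − η`, `|A_N − πf| ≤ 4C'/(εN) + √(8 C'² log(2/η) / (ε² N))`

HONEST FRAMING: exact (Metropolis-corrected) sampling algorithms for lattice gauge theory;
figures of merit are autocorrelation/cost numbers at stated couplings and volumes; no
continuum-physics claim.

Venture `LatticeQCDFlow` (cell pub-lqcd), topic `Scoring`; FANOUT row 8 (`s0-cpn-nemc`, GEN-13).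
NEW WORK of the cell, not a published result; no definition is introduced.  The two tail bounds of
the row, inverted into the form a practitioner quotes: the Gaussian tail of
`Scoring/ChainHoeffding.lean` (`chain_abs_tail_le_exp_of_doeblin`) becomes a confidence RADIUS at
level `1 − η` of order `√(log(2/η)/N)`, and the second-moment bound of
`Scoring/ChainMeanSquareError.lean` (`chain_mse_le_of_doeblin`) becomes, by Markov's inequality, the
Chebyshev companion of order `1/√(ηN)` — both from an arbitrary initial law, constants explicit in
the Doeblin constant `ε` and the observable's range.  Nothing is cited as a fact.

## Content (`κ` Markov, `π` invariant, `κ(x, ·) ≥ ε π`, `ε > 0`; `μ₀` ANY probability law;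
## `|f| ≤ C`, `C' = C + |πf|`; `A_N = (1/N) Σ_{i<N} f(X_i)`, `N ≥ 1`)

* `abs_timeAverage_sub_le` — `|A_N − πf| ≤ C'` surely;
* **`chain_confidence_of_doeblin`** — for `0 < η ≤ 1`:
  `P_{μ₀}(|A_N − πf| > 4C'/(εN) + √(8 C'² log(2/η)/(ε² N))) ≤ η`;
* **`chain_chebyshev_of_doeblin`** — for `s > 0`:
  `P_{μ₀}(|A_N − πf| ≥ s) ≤ ((2/ε − 1) Var_π f / N + 16 C'²/(ε² N²)) / s²`.

Reading (value-free): the Hoeffding radius does not see the variance (`C'` only) but pays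
`√log(2/η)`; the Chebyshev radius sees `Var_π f ≤ C'²` but pays `1/√η` — for error bars at high
confidence the first is the one to quote, for one-sigma-type statements the second; both are
theorems about the simulated chain with no thermalisation cut and no autocorrelation estimate.
NOT CLAIMED: any `ε` for a concrete sampler; a Bernstein-type radius combining both virtues;
unbounded observables.
-/

noncomputable section

namespace Summit.Ventures.LatticeQCDFlow.Scoring

open MeasureTheory ProbabilityTheory Filter Finset Preorder
open scoped ENNReal NNReal

variable {Ω : Type*} [MeasurableSpace Ω]
variable {κ : Kernel Ω Ω} [IsMarkovKernel κ] {μ₀ : Measure Ω} [IsProbabilityMeasure μ₀]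
  {π : Measure Ω} [IsProbabilityMeasure π]

omit [MeasurableSpace Ω] in
/-- `|A_N − πf| ≤ C + |πf|` surely (`N ≥ 1`). -/
theorem abs_timeAverage_sub_le {f : Ω → ℝ} {C : ℝ} (hC : ∀ x, |f x| ≤ C) {N : ℕ} (hN : N ≠ 0)
    (m : ℝ) (x : ℕ → Ω) : |(∑ i ∈ Finset.range N, f (x i)) / N - m| ≤ C + |m| :=
  (abs_sub _ _).trans (add_le_add (abs_timeAverage_le hC hN x) le_rfl)

/-- **CERTIFIED CONFIDENCE INTERVAL (Hoeffding form), ANY START.**  With `π` invariant,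
`κ(x, ·) ≥ ε π` (`ε > 0`), `|f| ≤ C`, `C' = C + |πf|`, for every initial law `μ₀`, every `N ≥ 1`
and every `0 < η ≤ 1`:
`P_{μ₀}(|(1/N) Σ_{i<N} f(X_i) − πf| > 4C'/(εN) + √(8 C'² log(2/η)/(ε² N))) ≤ η`. -/
theorem chain_confidence_of_doeblin (hπ : Kernel.Invariant κ π) {ε : ℝ≥0∞}
    (hmin : ∀ x {B : Set Ω}, MeasurableSet B → ε * π B ≤ κ x B) (hε0 : 0 < ε)
    {f : Ω → ℝ} (hf : Measurable f) {C : ℝ} (hC : ∀ x, |f x| ≤ C) {N : ℕ} (hN : N ≠ 0) {η : ℝ}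
    (hη0 : 0 < η) (hη1 : η ≤ 1) :
    (Kernel.trajMeasure (X := fun _ : ℕ => Ω) μ₀
          (fun m : ℕ => κ.comap (fun y : (i : ↥(Finset.Iic m)) → Ω => y ⟨m, Finset.mem_Iic.2 le_rfl⟩)
            (measurable_pi_apply _))).real
        {x | 4 * (C + |∫ z, f z ∂π|) / (ε.toReal * N)
              + Real.sqrt (8 * (C + |∫ z, f z ∂π|) ^ 2 * Real.log (2 / η) / (ε.toReal ^ 2 * N))
            < |(∑ i ∈ Finset.range N, f (x i)) / N - ∫ z, f z ∂π|}
      ≤ η := by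
  set P := Kernel.trajMeasure (X := fun _ : ℕ => Ω) μ₀
      (fun m : ℕ => κ.comap (fun y : (i : ↥(Finset.Iic m)) → Ω => y ⟨m, Finset.mem_Iic.2 le_rfl⟩)
        (measurable_pi_apply _)) with hP
  set m := ∫ z, f z ∂π with hm
  set Cp := C + |m| with hCp
  set e := ε.toReal with he
  set L := Real.log (2 / η) with hL
  obtain ⟨-, -, -, -, -, hεr0⟩ := half_const_bounds hmin hε0
  rw [← he] at hεr0
  have hNpos : (0 : ℝ) < N := by exact_mod_cast Nat.pos_of_ne_zero hN
  have hCp0 : 0 ≤ Cp := by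
    obtain ⟨x⟩ := nonempty_of_isProbabilityMeasure π
    exact add_nonneg ((abs_nonneg _).trans (hC x)) (abs_nonneg _)
  have hL0 : 0 ≤ L := Real.log_nonneg (by rw [le_div_iff₀ hη0]; linarith)
  have hbd : ∀ x : ℕ → Ω, |(∑ i ∈ Finset.range N, f (x i)) / N - m| ≤ Cp :=
    abs_timeAverage_sub_le hC hN m
  rcases hCp0.eq_or_lt with hzero | hpos
  · -- degenerate range: the event is empty
    have hempty : {x : ℕ → Ω | 4 * Cp / (e * N) + Real.sqrt (8 * Cp ^ 2 * L / (e ^ 2 * N))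
        < |(∑ i ∈ Finset.range N, f (x i)) / N - m|} = ∅ := by
      refine Set.eq_empty_iff_forall_notMem.2 fun x hx => ?_
      simp only [Set.mem_setOf_eq] at hx
      have h1 := hbd x
      rw [← hzero] at h1 hx
      have h2 : (0 : ℝ) ≤ Real.sqrt (8 * 0 ^ 2 * L / (e ^ 2 * N)) := Real.sqrt_nonneg _
      have h3 : 4 * (0 : ℝ) / (e * N) = 0 := by simp
      linarith
    rw [hempty, measureReal_empty]
    exact hη0.le
  · -- the radius makes the Hoeffding exponent equal to `−log(2/η)`
    set r := 4 * Cp / (e * N) + Real.sqrt (8 * Cp ^ 2 * L / (e ^ 2 * N)) with hr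
    have hy0 : 0 ≤ 8 * Cp ^ 2 * L / (e ^ 2 * N) := by positivity
    have hNr : N * r - 4 * Cp / e = N * Real.sqrt (8 * Cp ^ 2 * L / (e ^ 2 * N)) := by
      rw [hr, mul_add]
      have : (N : ℝ) * (4 * Cp / (e * N)) = 4 * Cp / e := by field_simp
      rw [this]; ring
    have hs : 4 * Cp / e ≤ N * r := by
      have : 0 ≤ (N : ℝ) * Real.sqrt (8 * Cp ^ 2 * L / (e ^ 2 * N)) := by positivity
      linarith
    have htail := chain_abs_tail_le_exp_of_doeblin (μ₀ := μ₀) hπ hmin hε0 hf hC hN hs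
    rw [← hP, ← hm, ← hCp, ← he] at htail
    have hexp : Real.exp (-(N * r - 4 * Cp / e) ^ 2 / (8 * N * Cp ^ 2 / e ^ 2)) = η / 2 := by
      rw [hNr, mul_pow, Real.sq_sqrt hy0]
      have hsimp : -((N : ℝ) ^ 2 * (8 * Cp ^ 2 * L / (e ^ 2 * N))) / (8 * N * Cp ^ 2 / e ^ 2) = -L := by
        field_simp
      rw [hsimp, hL, Real.exp_neg, Real.exp_log (by positivity), inv_div]
    rw [hexp] at htail
    calc P.real {x | r < |(∑ i ∈ Finset.range N, f (x i)) / N - m|}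
        ≤ P.real {x | r ≤ |(∑ i ∈ Finset.range N, f (x i)) / N - m|} :=
          measureReal_mono fun x (hx : r < _) => le_of_lt hx
      _ ≤ 2 * (η / 2) := htail
      _ = η := by ring

/-- **The Chebyshev companion, ANY START**: for `s > 0`,
`P_{μ₀}(|A_N − πf| ≥ s) ≤ ((2/ε − 1) Var_π f / N + 16 C'²/(ε² N²)) / s²`. -/
theorem chain_chebyshev_of_doeblin (hπ : Kernel.Invariant κ π) {ε : ℝ≥0∞}
    (hmin : ∀ x {B : Set Ω}, MeasurableSet B → ε * π B ≤ κ x B) (hε0 : 0 < ε)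
    {f : Ω → ℝ} (hf : Measurable f) {C : ℝ} (hC : ∀ x, |f x| ≤ C) {N : ℕ} (hN : N ≠ 0) {s : ℝ}
    (hs : 0 < s) :
    (Kernel.trajMeasure (X := fun _ : ℕ => Ω) μ₀
          (fun m : ℕ => κ.comap (fun y : (i : ↥(Finset.Iic m)) → Ω => y ⟨m, Finset.mem_Iic.2 le_rfl⟩)
            (measurable_pi_apply _))).real
        {x | s ≤ |(∑ i ∈ Finset.range N, f (x i)) / N - ∫ z, f z ∂π|}
      ≤ ((2 / ε.toReal - 1) * autocov κ π (fun y => f y - ∫ z, f z ∂π) 0 / N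
          + 16 * (C + |∫ z, f z ∂π|) ^ 2 / (ε.toReal ^ 2 * (N : ℝ) ^ 2)) / s ^ 2 := by
  set P := Kernel.trajMeasure (X := fun _ : ℕ => Ω) μ₀
      (fun m : ℕ => κ.comap (fun y : (i : ↥(Finset.Iic m)) → Ω => y ⟨m, Finset.mem_Iic.2 le_rfl⟩)
        (measurable_pi_apply _)) with hP
  set m := ∫ z, f z ∂π with hm
  have hmse := chain_mse_le_of_doeblin (μ₀ := μ₀) hπ hmin hε0 hf hC hN
  rw [← hP, ← hm] at hmse
  -- Markov's inequality for the squared error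
  have hmeas : Measurable fun x : ℕ → Ω => ((∑ i ∈ Finset.range N, f (x i)) / N - m) ^ 2 :=
    ((measurable_timeAverage hf N).sub measurable_const).pow_const 2
  have hbd : ∀ x : ℕ → Ω, |((∑ i ∈ Finset.range N, f (x i)) / N - m) ^ 2| ≤ (C + |m|) ^ 2 := fun x => by
    have h1 := abs_timeAverage_sub_le hC hN m x
    rw [abs_pow]
    exact sq_le_sq' (by linarith [abs_nonneg ((∑ i ∈ Finset.range N, f (x i)) / N - m)]) h1
  have hint : Integrable (fun x : ℕ → Ω => ((∑ i ∈ Finset.range N, f (x i)) / N - m) ^ 2) P :=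
    integrable_of_bounded P hmeas hbd
  have hmarkov := mul_meas_ge_le_integral_of_nonneg (μ := P) (ae_of_all _ fun x => sq_nonneg _)
    hint (s ^ 2)
  have hsub : {x : ℕ → Ω | s ≤ |(∑ i ∈ Finset.range N, f (x i)) / N - m|}
      ⊆ {x | s ^ 2 ≤ ((∑ i ∈ Finset.range N, f (x i)) / N - m) ^ 2} := fun x hx => by
    simp only [Set.mem_setOf_eq] at hx ⊢
    calc s ^ 2 ≤ |(∑ i ∈ Finset.range N, f (x i)) / N - m| ^ 2 :=
          pow_le_pow_left₀ hs.le hx 2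
      _ = ((∑ i ∈ Finset.range N, f (x i)) / N - m) ^ 2 := sq_abs _
  have hs2 : 0 < s ^ 2 := by positivity
  calc P.real {x | s ≤ |(∑ i ∈ Finset.range N, f (x i)) / N - m|}
      ≤ P.real {x | s ^ 2 ≤ ((∑ i ∈ Finset.range N, f (x i)) / N - m) ^ 2} := measureReal_mono hsub
    _ ≤ (∫ x, ((∑ i ∈ Finset.range N, f (x i)) / N - m) ^ 2 ∂P) / s ^ 2 := by
        rw [le_div_iff₀ hs2, mul_comm]; exact hmarkov
    _ ≤ _ := div_le_div_of_nonneg_right hmse hs2.le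

end Summit.Ventures.LatticeQCDFlow.Scoring

end
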